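import Literature.AlgebraicGeometry.Resolution.ArithmeticalThreefoldsLocalDescentKummerStableLocalRing
import HarnessLib

/-!
# Unramified descent split into its two layers ([CoP1] Prop. 9.3: decomposition layer and inertia layer)

Topic: `Literature/AlgebraicGeometry/Resolution`. PROOF side of `CossartPiltant2019ReductionP`
(`ArithmeticalThreefoldsLocal.lean`), input (C4). The hypothesis `hUnram` of
`cossartPiltant2019ReductionP_of_cjs_of_stableLocalRing` is [CoP1] Prop. 9.3: `(LU K′) ⇒ (LU M)`
for `M ≤ K′ ≤ Mⁱ` (the inertia field of the valuation in a finite Galois `N | M`). Its printed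
proof (HAL pp. 26–28) treats the two layers of `M ≤ Mˢ ≤ Mⁱ` differently:

> Assume that the statement of the proposition holds whenever `K′ = Kˢ`. Then … we have reduced
> the proposition to the case `K′ = Kˢ`, which we assume from now on. [HAL p. 27: then the
> `m`-adic density of `R₁` in `R₁′ ⊂ R₁ʰ`, Prop. 8.1, the `F_i / H_j` construction and Zariski's
> Main Theorem]

— the DECOMPOSITION layer `M ≤ K′ ≤ Mˢ` (density + ZMT, printed in full) — and

> the unique normal local model `S₀ⁱ` of `W ∩ Kⁱ/k` lying above `S₀′` is regular. Now, the
> invariant ring `S₀ˢ := (S₀ⁱ)^{Gˢ(W/V)/Gⁱ(W/V)} ⊂ Kˢ` is a normal local model of `Vˢ/k` …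
> local-étale … so that `S₀ˢ` is regular

— the INERTIA layer `Mˢ ≤ K′ ≤ Mⁱ` (invariants of a `Gal(Mⁱ|Mˢ)`-STABLE regular model and étale
descent; the stability is used silently, as in Lemma 9.4). This file separates the two layers
in the climbing frame: `hUnram` follows from `hDec` (Prop. 9.3 for `K′ ≤ Mˢ`) and `hInert`
(`(LU K′) ⇒ (LU Mˢ)` for `Mˢ ≤ K′ ≤ Mⁱ`), via the étale climb to the decomposition field over
`K′` (`exists_model_of_henselRoot_of_cofinal`, Cor. 6.3) and Lemma 6.1 (1) for `G_Z`.

* `lift_fixedField_decompositionGroupIn_extendScalars_eq` — PROVED: [CoP1] Lemma 6.1 (1) for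
  the decomposition group as an equality of subfields after rebasing;
* `unramifiedDescent_of_layers` — PROVED: `hUnram` from cofinality, `hDec` and `hInert`;
* `cossartPiltant2019ReductionP_of_cjs_of_layers` — PROVED:
  `CossartPiltant2019Local → CossartPiltant2019Principalization → CossartJannsenSaito2020General →
  (embedded resolution of surfaces) → ("S is stable by G") → (inertia layer) →
  (Prop. 9.3, decomposition layer) → CossartPiltant2019ReductionP`.

Everything is PROVED; no named facts are introduced.

## Sources

* V. Cossart, O. Piltant, J. Algebra 320 (2008) 1051–1082: Lemma 6.1, Cor. 6.3, Prop. 9.3 and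
  its proof (HAL hal-00139124, pp. 17–18, 26–28). [CossartPiltant2008]
* V. Cossart, O. Piltant, J. Algebra 529 (2019) 268–535 = arXiv:1412.0868, proof of Prop. 4.10
  (arXiv v1: Prop. 4.8, p. 54). [CossartPiltant2019]
-/

noncomputable section

open CategoryTheory AlgebraicGeometry TopologicalSpace IsLocalRing _root_.Polynomial
  _root_.IntermediateField

namespace Literature.AlgebraicGeometry.Resolution

universe u

/-! ## Lemma 6.1 (1) for the decomposition group -/

section Towers

variable {Ω : Type u} [Field Ω] {M : Subfield Ω} (N : IntermediateField M Ω)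

/-- **[CoP1] Lemma 6.1 (1) for the decomposition group, inside `Ω`**: for `N | M` finite Galois
with valuation ring `V ∩ N` and an intermediate field `L′`, the decomposition field of `N` over
`L′` (computed after rebasing with `TameTowerRebase.lean`) is the fixed field of
`G_Z(N|M) ∩ Gal(N|L′)` ("`Gˢ(S/R′) = Gˢ(S/R) ∩ Gal(L/K′)`": the defining condition of `G_Z`
does not mention the base field). [cite: CossartPiltant2008, Lemma 6.1 (1) (HAL p. 17)] -/
theorem lift_fixedField_decompositionGroupIn_extendScalars_eq (V : ValuationSubring Ω)
    [FiniteDimensional M N] [IsGalois M N] (L' : IntermediateField M N) :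
    (lift (fixedField (decompositionGroupIn V
        (Subfield.extendScalars (lift_toSubfield_le L'))))).toSubfield =
      (lift (fixedField (decompositionGroupIn V N ⊓ L'.fixingSubgroup))).toSubfield := by
  classical
  obtain ⟨ψ, hψ⟩ := exists_rebaseAutEquiv L'
  -- the decomposition condition transfers along `ψ`
  have key : ∀ σ, σ ∈ decompositionGroupIn V (Subfield.extendScalars (lift_toSubfield_le L')) ↔
      ((ψ σ : L'.fixingSubgroup) : N ≃ₐ[M] N) ∈ decompositionGroupIn V N := by
    intro σ
    rw [mem_decompositionGroupIn_iff, mem_decompositionGroupIn_iff]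
    constructor
    · intro h1 y
      rw [hψ σ y]
      exact h1 ⟨(y : Ω), (mem_extendScalars_lift_iff L' y).mpr y.2⟩
    · intro h1 y
      have hyN : (y : Ω) ∈ N := (mem_extendScalars_lift_iff L' y).mp y.2
      have h := h1 ⟨y, hyN⟩
      rw [hψ σ ⟨y, hyN⟩] at h
      exact h
  ext x
  constructor
  · intro hx
    have hxN' : x ∈ Subfield.extendScalars (lift_toSubfield_le L') :=
      IntermediateField.lift_le _ hx
    have hxN : x ∈ N := (mem_extendScalars_lift_iff L' x).mp hxN'
    have hx' := (IntermediateField.mem_lift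
      (⟨x, hxN'⟩ : Subfield.extendScalars (lift_toSubfield_le L'))).mp hx
    rw [IntermediateField.mem_fixedField_iff] at hx'
    refine (IntermediateField.mem_lift (⟨x, hxN⟩ : N)).mpr ?_
    rw [IntermediateField.mem_fixedField_iff]
    intro τ hτ
    obtain ⟨hτs, hτU⟩ := Subgroup.mem_inf.mp hτ
    set σ := ψ.symm ⟨τ, hτU⟩ with hσ
    have hψσ : ((ψ σ : L'.fixingSubgroup) : N ≃ₐ[M] N) = τ := by
      rw [hσ, MulEquiv.apply_symm_apply]
    have hσs : σ ∈ decompositionGroupIn V (Subfield.extendScalars (lift_toSubfield_le L')) :=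
      (key σ).mpr (by rw [hψσ]; exact hτs)
    have hfix := hx' σ hσs
    apply Subtype.ext
    change ((τ ⟨x, hxN⟩ : N) : Ω) = x
    rw [← hψσ, hψ σ ⟨x, hxN⟩]
    exact congrArg Subtype.val hfix
  · intro hx
    have hxN : x ∈ N := IntermediateField.lift_le _ hx
    have hx' : (⟨x, hxN⟩ : N) ∈ fixedField (decompositionGroupIn V N ⊓ L'.fixingSubgroup) :=
      (IntermediateField.mem_lift (⟨x, hxN⟩ : N)).mp hx
    rw [IntermediateField.mem_fixedField_iff] at hx'
    have hxN' : x ∈ Subfield.extendScalars (lift_toSubfield_le L') :=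
      (mem_extendScalars_lift_iff L' x).mpr hxN
    refine (IntermediateField.mem_lift
      (⟨x, hxN'⟩ : Subfield.extendScalars (lift_toSubfield_le L'))).mpr ?_
    rw [IntermediateField.mem_fixedField_iff]
    intro σ hσ
    have hψσ : ((ψ σ : L'.fixingSubgroup) : N ≃ₐ[M] N) ∈
        decompositionGroupIn V N ⊓ L'.fixingSubgroup :=
      Subgroup.mem_inf.mpr ⟨(key σ).mp hσ, (ψ σ).2⟩
    have hfix := hx' _ hψσ
    have h1 : (((ψ σ : L'.fixingSubgroup) : N ≃ₐ[M] N) ⟨x, hxN⟩ : Ω) = (σ ⟨x, hxN'⟩ : Ω) :=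
      hψ σ ⟨x, hxN⟩
    apply Subtype.ext
    change (σ ⟨x, hxN'⟩ : Ω) = x
    rw [← h1, hfix]

end Towers

/-! ## Prop. 9.3 from its two layers -/

section Assembly

variable {S E : Type u} [CommRing S] [Field E] [Algebra S E]

/-- **[CoP1] Prop. 9.3 from its decomposition layer and its inertia layer.** Frame: `S` in an
ambient valued field `(E, O_E)`; `(LU X)` for a subfield `X ∋ S` means a model `S[t] ⊆ O_E`,
`t ⊆ X ⊆ Frac(S)(t)`, regular at the centre. Hypotheses at every subfield `∋ S`: cofinality
(`hCOF`, [CoP1] Cor. 4.6), `hDec` (`(LU K′) ⇒ (LU M)` for `M ≤ K′ ≤ Mˢ`, Prop. 9.3 in the case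
"`K′ = Kˢ`" of its printed proof) and `hInert` (`(LU K′) ⇒ (LU Mˢ)` for `Mˢ ≤ K′ ≤ Mⁱ`).
Claim: `(LU K′) ⇒ (LU M)` for `M ≤ K′ ≤ Mⁱ`. Proof: the decomposition field of the valuation
over `K′` is `N^{G_Z ∩ Gal(N|K′)} ⊇ Mˢ` (Lemma 6.1 (1)) and lies in `Mⁱ` (as `G_T ≤ Gal(N|K′)`);
`(LU K′)` climbs to it along a henselian element (`exists_model_of_henselRoot_of_cofinal`,
Cor. 6.3); then `hInert` and `hDec`.
[cite: CossartPiltant2008, Prop. 9.3 and its proof (HAL pp. 26–27)] -/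
theorem unramifiedDescent_of_layers (OE : ValuationSubring E)
    (hCOF : ∀ (M : Subfield E), (∀ s : S, algebraMap S E s ∈ M) →
      ∀ (t : Finset E), (t : Set E) ⊆ M →
        M ≤ Subfield.closure (Set.range (algebraMap S E) ∪ (t : Set E)) →
      ∀ (hTO : (Algebra.adjoin S (t : Set E)).toSubring ≤ OE.toSubring),
        IsRegularLocalRing (Localization.AtPrime
          (Ideal.comap (Subring.inclusion hTO) (maximalIdeal OE))) →
      ∀ (c : Finset E), (c : Set E) ⊆ M → (∀ x ∈ c, x ∈ OE) →
      ∃ t' : Finset E, (t' : Set E) ⊆ M ∧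
        M ≤ Subfield.closure (Set.range (algebraMap S E) ∪ (t' : Set E)) ∧
        ∃ hTO' : (Algebra.adjoin S (t' : Set E)).toSubring ≤ OE.toSubring,
          IsRegularLocalRing (Localization.AtPrime
            (Ideal.comap (Subring.inclusion hTO') (maximalIdeal OE))) ∧
          ∀ x ∈ c, ∃ a s : E, a ∈ Algebra.adjoin S (t' : Set E) ∧
            s ∈ Algebra.adjoin S (t' : Set E) ∧ OE.valuation s = 1 ∧ x * s = a)
    (hDec : ∀ (M : Subfield E), (∀ s : S, algebraMap S E s ∈ M) →
      ∀ (N : IntermediateField M E) [FiniteDimensional M N] [IsGalois M N] (K' : Subfield E),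
        M ≤ K' → K' ≤ (lift (fixedField (decompositionGroupIn OE N))).toSubfield →
        (∃ t : Finset E, (t : Set E) ⊆ K' ∧
          K' ≤ Subfield.closure (Set.range (algebraMap S E) ∪ (t : Set E)) ∧
          ∃ hTO : (Algebra.adjoin S (t : Set E)).toSubring ≤ OE.toSubring,
            IsRegularLocalRing (Localization.AtPrime
              (Ideal.comap (Subring.inclusion hTO) (maximalIdeal OE)))) →
        (∃ t : Finset E, (t : Set E) ⊆ M ∧
          M ≤ Subfield.closure (Set.range (algebraMap S E) ∪ (t : Set E)) ∧
          ∃ hTO : (Algebra.adjoin S (t : Set E)).toSubring ≤ OE.toSubring,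
            IsRegularLocalRing (Localization.AtPrime
              (Ideal.comap (Subring.inclusion hTO) (maximalIdeal OE)))))
    (hInert : ∀ (M : Subfield E), (∀ s : S, algebraMap S E s ∈ M) →
      ∀ (N : IntermediateField M E) [FiniteDimensional M N] [IsGalois M N] (K' : Subfield E),
        (lift (fixedField (decompositionGroupIn OE N))).toSubfield ≤ K' →
        K' ≤ (lift (fixedField (inertiaGroupIn OE N))).toSubfield →
        (∃ t : Finset E, (t : Set E) ⊆ K' ∧
          K' ≤ Subfield.closure (Set.range (algebraMap S E) ∪ (t : Set E)) ∧
          ∃ hTO : (Algebra.adjoin S (t : Set E)).toSubring ≤ OE.toSubring,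
            IsRegularLocalRing (Localization.AtPrime
              (Ideal.comap (Subring.inclusion hTO) (maximalIdeal OE)))) →
        (∃ t : Finset E, (t : Set E) ⊆ (lift (fixedField (decompositionGroupIn OE N))).toSubfield ∧
          (lift (fixedField (decompositionGroupIn OE N))).toSubfield ≤
            Subfield.closure (Set.range (algebraMap S E) ∪ (t : Set E)) ∧
          ∃ hTO : (Algebra.adjoin S (t : Set E)).toSubring ≤ OE.toSubring,
            IsRegularLocalRing (Localization.AtPrime
              (Ideal.comap (Subring.inclusion hTO) (maximalIdeal OE)))))
    (M : Subfield E) (hSM : ∀ s : S, algebraMap S E s ∈ M)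
    (N : IntermediateField M E) [FiniteDimensional M N] [IsGalois M N] (K' : Subfield E)
    (hMK' : M ≤ K') (hK'i : K' ≤ (lift (fixedField (inertiaGroupIn OE N))).toSubfield)
    (hLUK' : ∃ t : Finset E, (t : Set E) ⊆ K' ∧
      K' ≤ Subfield.closure (Set.range (algebraMap S E) ∪ (t : Set E)) ∧
      ∃ hTO : (Algebra.adjoin S (t : Set E)).toSubring ≤ OE.toSubring,
        IsRegularLocalRing (Localization.AtPrime
          (Ideal.comap (Subring.inclusion hTO) (maximalIdeal OE)))) :
    ∃ t : Finset E, (t : Set E) ⊆ M ∧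
      M ≤ Subfield.closure (Set.range (algebraMap S E) ∪ (t : Set E)) ∧
      ∃ hTO : (Algebra.adjoin S (t : Set E)).toSubring ≤ OE.toSubring,
        IsRegularLocalRing (Localization.AtPrime
          (Ideal.comap (Subring.inclusion hTO) (maximalIdeal OE))) := by
  classical
  -- `K′` as an intermediate field `L′` of `N | M`
  have hK'N : K' ≤ N.toSubfield := hK'i.trans (lift_toSubfield_le _)
  obtain ⟨L', hL', -⟩ := exists_intermediateField_lift_toSubfield_eq N K' hMK' hK'N
  subst hL'
  haveI := finiteDimensional_extendScalars_lift L'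
  haveI := isGalois_extendScalars_lift L'
  have hSK' : ∀ s : S, algebraMap S E s ∈ (lift L').toSubfield := fun s => hMK' (hSM s)
  /- Step 1 (Cor. 6.3): `(LU K′) ⇒ (LU Z′)`, `Z′` the decomposition field of the valuation over `K′` -/
  obtain ⟨η, hηV, -, ⟨F, hFmon, hFcoeff, hFη, hF'⟩, hZeq⟩ :=
    exists_henselRoot_toSubfield_decompositionField_eq OE
      (Subfield.extendScalars (lift_toSubfield_le L'))
  have hLUZ := exists_model_of_henselRoot_of_cofinal OE (lift L').toSubfield
    (hCOF (lift L').toSubfield hSK') hLUK' η hηV F hFmon hFcoeff hFη hF'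
  rw [← hZeq, lift_fixedField_decompositionGroupIn_extendScalars_eq N OE L'] at hLUZ
  /- Step 2: `Mˢ ≤ Z′ ≤ Mⁱ` -/
  have hGi : inertiaGroupIn OE N ≤ L'.fixingSubgroup := by
    have hL'le : L' ≤ fixedField (inertiaGroupIn OE N) := by
      intro x hx
      have h1 : (x : E) ∈ (lift L').toSubfield := (IntermediateField.mem_lift x).mpr hx
      exact (IntermediateField.mem_lift x).mp (hK'i h1)
    exact (IntermediateField.le_iff_le _ _).mp hL'le
  have hsZ : (lift (fixedField (decompositionGroupIn OE N))).toSubfield ≤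
      (lift (fixedField (decompositionGroupIn OE N ⊓ L'.fixingSubgroup))).toSubfield :=
    lift_fixedField_toSubfield_mono inf_le_left
  have hZi : (lift (fixedField (decompositionGroupIn OE N ⊓ L'.fixingSubgroup))).toSubfield ≤
      (lift (fixedField (inertiaGroupIn OE N))).toSubfield :=
    lift_fixedField_toSubfield_mono
      (le_inf (inertiaGroupIn_le_decompositionGroupIn OE N) hGi)
  /- Step 3: the inertia layer, then the decomposition layer -/
  have hLUs := hInert M hSM N _ hsZ hZi hLUZ
  exact hDec M hSM N _ (le_lift_toSubfield _) le_rfl hLUs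

end Assembly

/-! ## The reduction with every transfer input split down to its printed or unprinted atom -/

/-- **Cossart–Piltant 2019, Prop. 4.10 from Thm. 1.5, principalization, resolution of excellent
surfaces (embedded and non-embedded), "S is stable by G", the inertia layer and the
decomposition layer of [CoP1] Prop. 9.3**: `cossartPiltant2019ReductionP_of_cjs_of_stableLocalRing`
with `hUnram` assembled by `unramifiedDescent_of_layers`. After this theorem the transfer part
(C3)+(C4)+(C5) of the printed reduction `Thm. 1.5 ⇒ Thm. 1.1` rests on: `hDec` = [CoP1]
Prop. 9.3 for `K′ ≤ Mˢ` (printed proof complete: density, Prop. 8.1, ZMT); `hInert` =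
`(LU K′) ⇒ (LU Mˢ)` for `Mˢ ≤ K′ ≤ Mⁱ` and `hStabLoc` = "S is stable by G" in totally ramified
Kummer steps — the two places where the printed argument takes invariants of a regular local
model under a Galois group without proving the model stable.
[cite: CossartPiltant2019, Props. 4.3, 4.4 and proof of Prop. 4.10 (arXiv v1: Props. 4.2, 4.3, 4.8, pp. 50–54)]
[cite: CossartPiltant2008, Lemma 9.4, Prop. 9.3, Prop. 9.5 (HAL pp. 26–30)]
[cite: CossartJannsenSaito2020, Thm. 1.2, Cor. 1.5] -/
theorem cossartPiltant2019ReductionP_of_cjs_of_layers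
    (hloc : CossartPiltant2019Local.{u}) (h44 : CossartPiltant2019Principalization.{u})
    (hCJS : CossartJannsenSaito2020General.{u})
    (hEmb : ∀ (Z : Scheme.{u}) [IsIntegral Z] [IsNoetherian Z], Scheme.IsRegular Z →
      Scheme.IsExcellent Z → ∀ (X : Set Z), IsClosed X → X ≠ Set.univ → topologicalKrullDim X ≤ 2 →
        ∃ (Z' : Scheme.{u}) (π : Z' ⟶ Z), IsProper π ∧ Function.Surjective π.base ∧
          (∃ U : Z.Opens, (U : Set Z) = Xᶜ ∧ IsIso (π ∣_ U)) ∧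
          IsStrictNormalCrossingsDivisor Z' (π.base ⁻¹' X))
    (hStabLoc :
      ∀ (p : ℕ), p.Prime →
      ∀ (S : Type u) [CommRing S] [IsDomain S] [IsRegularLocalRing S],
        IsExcellentRing S → ringKrullDim S = 3 → CharP (ResidueField S) p →
        IsAdicComplete (maximalIdeal S) S →
      ∀ (E : Type u) [Field E] [Algebra S E], Function.Injective (algebraMap S E) →
        IsAlgClosed E → Algebra.IsAlgebraic S E →
      ∀ (OE : ValuationSubring E), (∀ s : S, algebraMap S E s ∈ OE) →
        (∀ s ∈ maximalIdeal S, OE.valuation (algebraMap S E s) < 1) →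
        (∀ y : OE, ∃ q : S[X], (∃ i, q.coeff i ∉ maximalIdeal S) ∧
          OE.valuation (q.eval₂ (algebraMap S E) y) < 1) →
      Nonempty OE.valuation.RankOne →
      ∀ (ℓ : ℕ), ℓ.Prime → ℓ ≠ p → ∀ (ζ : E), IsPrimitiveRoot ζ ℓ →
      ∀ (A : Subfield E), (∀ s : S, algebraMap S E s ∈ A) → ζ ∈ A →
      ∀ (θ : E), θ ∉ A → θ ^ ℓ ∈ A → OE.valuation θ ≤ 1 →
        Module.finrank A (adjoin A ({θ} : Set E)) = ℓ → IsGalois A (adjoin A ({θ} : Set E)) →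
        inertiaGroupIn OE (adjoin A ({θ} : Set E)) = ⊤ →
        (∃ t : Finset E, (t : Set E) ⊆ (adjoin A ({θ} : Set E)).toSubfield ∧
          (adjoin A ({θ} : Set E)).toSubfield ≤
            Subfield.closure (Set.range (algebraMap S E) ∪ (t : Set E)) ∧
          ∃ hTO : (Algebra.adjoin S (t : Set E)).toSubring ≤ OE.toSubring,
            IsRegularLocalRing (Localization.AtPrime
              (Ideal.comap (Subring.inclusion hTO) (maximalIdeal OE)))) →
        (∃ t : Finset E, (t : Set E) ⊆ (adjoin A ({θ} : Set E)).toSubfield ∧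
          (adjoin A ({θ} : Set E)).toSubfield ≤
            Subfield.closure (Set.range (algebraMap S E) ∪ (t : Set E)) ∧
          ∃ hTO : (Algebra.adjoin S (t : Set E)).toSubring ≤ OE.toSubring,
            IsRegularLocalRing (Localization.AtPrime
              (Ideal.comap (Subring.inclusion hTO) (maximalIdeal OE))) ∧
            ∀ (τ : adjoin A ({θ} : Set E) ≃ₐ[A] adjoin A ({θ} : Set E))
              (x : adjoin A ({θ} : Set E)),
              (x : E) ∈ locAtCentre (Algebra.adjoin S (t : Set E)).toSubring OE →
              ((τ x : adjoin A ({θ} : Set E)) : E) ∈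
                locAtCentre (Algebra.adjoin S (t : Set E)).toSubring OE))
    (hInert :
      ∀ (p : ℕ), p.Prime →
      ∀ (S : Type u) [CommRing S] [IsDomain S] [IsRegularLocalRing S],
        IsExcellentRing S → ringKrullDim S = 3 → CharP (ResidueField S) p →
        IsAdicComplete (maximalIdeal S) S →
      ∀ (E : Type u) [Field E] [Algebra S E], Function.Injective (algebraMap S E) →
        IsAlgClosed E → Algebra.IsAlgebraic S E →
      ∀ (OE : ValuationSubring E), (∀ s : S, algebraMap S E s ∈ OE) →
        (∀ s ∈ maximalIdeal S, OE.valuation (algebraMap S E s) < 1) →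
        (∀ y : OE, ∃ q : S[X], (∃ i, q.coeff i ∉ maximalIdeal S) ∧
          OE.valuation (q.eval₂ (algebraMap S E) y) < 1) →
      Nonempty OE.valuation.RankOne →
      ∀ (M : Subfield E), (∀ s : S, algebraMap S E s ∈ M) →
      ∀ (N : IntermediateField M E) [FiniteDimensional M N] [IsGalois M N] (K' : Subfield E),
        (lift (fixedField (decompositionGroupIn OE N))).toSubfield ≤ K' →
        K' ≤ (lift (fixedField (inertiaGroupIn OE N))).toSubfield →
        (∃ t : Finset E, (t : Set E) ⊆ K' ∧
          K' ≤ Subfield.closure (Set.range (algebraMap S E) ∪ (t : Set E)) ∧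
          ∃ hTO : (Algebra.adjoin S (t : Set E)).toSubring ≤ OE.toSubring,
            IsRegularLocalRing (Localization.AtPrime
              (Ideal.comap (Subring.inclusion hTO) (maximalIdeal OE)))) →
        (∃ t : Finset E, (t : Set E) ⊆ (lift (fixedField (decompositionGroupIn OE N))).toSubfield ∧
          (lift (fixedField (decompositionGroupIn OE N))).toSubfield ≤
            Subfield.closure (Set.range (algebraMap S E) ∪ (t : Set E)) ∧
          ∃ hTO : (Algebra.adjoin S (t : Set E)).toSubring ≤ OE.toSubring,
            IsRegularLocalRing (Localization.AtPrime
              (Ideal.comap (Subring.inclusion hTO) (maximalIdeal OE)))))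
    (hDec :
      ∀ (p : ℕ), p.Prime →
      ∀ (S : Type u) [CommRing S] [IsDomain S] [IsRegularLocalRing S],
        IsExcellentRing S → ringKrullDim S = 3 → CharP (ResidueField S) p →
        IsAdicComplete (maximalIdeal S) S →
      ∀ (E : Type u) [Field E] [Algebra S E], Function.Injective (algebraMap S E) →
        IsAlgClosed E → Algebra.IsAlgebraic S E →
      ∀ (OE : ValuationSubring E), (∀ s : S, algebraMap S E s ∈ OE) →
        (∀ s ∈ maximalIdeal S, OE.valuation (algebraMap S E s) < 1) →
        (∀ y : OE, ∃ q : S[X], (∃ i, q.coeff i ∉ maximalIdeal S) ∧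
          OE.valuation (q.eval₂ (algebraMap S E) y) < 1) →
      Nonempty OE.valuation.RankOne →
      ∀ (M : Subfield E), (∀ s : S, algebraMap S E s ∈ M) →
      ∀ (N : IntermediateField M E) [FiniteDimensional M N] [IsGalois M N] (K' : Subfield E),
        M ≤ K' → K' ≤ (lift (fixedField (decompositionGroupIn OE N))).toSubfield →
        (∃ t : Finset E, (t : Set E) ⊆ K' ∧
          K' ≤ Subfield.closure (Set.range (algebraMap S E) ∪ (t : Set E)) ∧
          ∃ hTO : (Algebra.adjoin S (t : Set E)).toSubring ≤ OE.toSubring,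
            IsRegularLocalRing (Localization.AtPrime
              (Ideal.comap (Subring.inclusion hTO) (maximalIdeal OE)))) →
        (∃ t : Finset E, (t : Set E) ⊆ M ∧
          M ≤ Subfield.closure (Set.range (algebraMap S E) ∪ (t : Set E)) ∧
          ∃ hTO : (Algebra.adjoin S (t : Set E)).toSubring ≤ OE.toSubring,
            IsRegularLocalRing (Localization.AtPrime
              (Ideal.comap (Subring.inclusion hTO) (maximalIdeal OE))))) :
    CossartPiltant2019ReductionP.{u} :=
  cossartPiltant2019ReductionP_of_cjs_of_stableLocalRing hloc h44 hCJS hEmb hStabLoc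
    (fun p hp S _ _ _ hS hSdim hSchar hScomp E _ _ hinj hE halg OE hSO hdom hres hrk M hSM N _ _ K'
        hMK' hK'i hLUK' => by
      haveI := hE
      haveI := halg
      exact unramifiedDescent_of_layers OE
        (cofinality_of_principalization h44 p hp S hS hSdim hSchar hScomp E hinj hE halg OE hSO hdom
          hres)
        (fun M' hSM' N' _ _ => hDec p hp S hS hSdim hSchar hScomp E hinj hE halg OE hSO hdom hres hrk
          M' hSM' N')
        (fun M' hSM' N' _ _ => hInert p hp S hS hSdim hSchar hScomp E hinj hE halg OE hSO hdom hres
          hrk M' hSM' N')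
        M hSM N K' hMK' hK'i hLUK')

end Literature.AlgebraicGeometry.Resolution

end
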